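import Mathlib
import Summits.KontsevichZagierPeriods.Zeta5Search.ClassDigitLawProof
import Summits.KontsevichZagierPeriods.Zeta5Search.UniversalDigitV
import Summits.KontsevichZagierPeriods.Zeta5Search.ZeroEvaluationProof
import HarnessLib

/-!
# ζ(5) search — CLASS-DIGIT LAW, proofs II: the first-order digit congruences and the leading digit of `V_x`

Cell `pub-zeta5`, track DENOM-LAW (D1; statements denom-theory-d1 g3/g4, proofs denom-theory-d1 g5, filed by denom-prover-d1 g4).
HONEST FRAMING: systematic search; identities and `p`-adic valuations of the cell's own partial-fraction coefficients
`c_{σ−1,q}` (rational numbers) in the window `p² > b₀ + 2`; nothing about ζ(5); no irrationality claim; records in print UNMOVED.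

This file proves `DigitCongruenceU`, `DigitCongruenceW` (Theorem B `leadingDigit_holds` pole by pole, summed) and `LeadingDigitV`
(Theorem B per pole + the harmonic splitting `‖p^i H^{(i)}_q − H^{(i)}_{⌊q/p⌋}‖_p ≤ p^{−i}`, `harm_split_norm`) of `ClassDigitLaw.lean`,
verbatim from the certified scratch monolith `denom-law/code/d1g5/lean/ClassDigitLawProof5.lean` (sha256 3ec15a59…); it uses the
valuation helpers and `classCofactor_integral` / `pfData_eq_zero_of_lt` of `ClassDigitLawProof.lean`, and reuses the tree's `CellA.harm_succ`
(`UniversalDigitV`) and `ClusterValuation.padicNorm_inv_pow_le_one` (`ZeroEvaluationProof`) instead of re-declaring them.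
-/

noncomputable section

open Finset PowerSeries

namespace Summit.KontsevichZagierPeriods.Zeta5Search.ClassDigitLaw

open Summit.KontsevichZagierPeriods.Zeta5Search.DualSeries (InBox)
open Summit.KontsevichZagierPeriods.Zeta5Search.CasoratianValuation (InPolytope)
open Summit.KontsevichZagierPeriods.Zeta5Search.WedgeDictionary (coeffU coeffW pfData)
open Summit.KontsevichZagierPeriods.Zeta5Search.ClusterValuation
open Summit.KontsevichZagierPeriods.Zeta5Search.PadicSeries
open Literature.NumberTheory.Transcendental.BallRivoal (harm)

/-! ## The first-order digit congruence (the `N = 1` reading, via Theorem B pole by pole) -/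

/-- **The cross-class digit congruence for the order-`σ` coefficient sum** (`σ = 5`: `U`; `σ = 3`: `W`). -/
theorem digitCongruence (b : ℕ → ℤ) {p : ℕ} (m : ℤ) {σ : ℕ} (hb : InPolytope b) (hprime : p.Prime)
    (hp5 : 5 ≤ p) (hwin : (b 0 + 2 : ℤ) < (p : ℤ) ^ 2) (hσ1 : 1 ≤ σ) (hσ6 : σ ≤ 6)
    (hm : ∀ q, q ≤ (b 0).toNat → netExp b q ≤ -(σ : ℤ) → m ≤ (σ : ℤ) + classExp b p q)
    (hne : (∑ q ∈ range ((b 0).toNat + 1), pfData b (σ - 1) q) - (-(p : ℚ)) ^ m * digitSum b p σ m ≠ 0) :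
    m + 1 ≤ padicValRat p
      ((∑ q ∈ range ((b 0).toNat + 1), pfData b (σ - 1) q) - (-(p : ℚ)) ^ m * digitSum b p σ m) := by
  haveI : Fact p.Prime := ⟨hprime⟩
  obtain ⟨hbox, _hhalf, _hpf, hn⟩ := thmA_data b hb hwin
  have h0 : 0 ≤ b 0 := hbox.1
  have hp2 : p ≠ 2 := by omega
  rw [digitSum, sum_filter, mul_sum, ← sum_sub_distrib] at hne ⊢
  refine val_ge_of_padicNorm_le hne (padicNorm.sum_le' (fun q hq => ?_) (zpow_p_nonneg _))
  have hq' : q ≤ (b 0).toNat := Nat.lt_succ_iff.1 (mem_range.1 hq)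
  by_cases hA : netExp b q ≤ -(σ : ℤ)
  · have hmq := hm q hq' hA
    -- Theorem B in norm form
    have hLD : padicNorm p (pfData b (σ - 1) q -
        (-(p : ℚ)) ^ ((σ : ℤ) + classExp b p q) * gHat b p q * classRho b p q σ) ≤
        (p : ℚ) ^ (-((σ : ℤ) + classExp b p q + 1)) :=
      padicNorm_le_of_val fun hne0 => leadingDigit_holds b p q σ hb hprime hp5 hwin hq' hσ1 (by omega) hne0
    by_cases hB : (σ : ℤ) + classExp b p q = m
    · rw [if_pos ⟨hA, hB⟩, ← hB]
      have e : pfData b (σ - 1) q - (-(p : ℚ)) ^ ((σ : ℤ) + classExp b p q) * (gHat b p q * classRho b p q σ) =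
          pfData b (σ - 1) q - (-(p : ℚ)) ^ ((σ : ℤ) + classExp b p q) * gHat b p q * classRho b p q σ := by
        ring
      rw [e]
      exact hLD
    · rw [if_neg (fun h => hB h.2), mul_zero, sub_zero]
      -- the main term is `O(p^{σ+E})` with `σ + E ≥ m + 1`
      have hg : padicNorm p (gHat b p q) ≤ 1 := by
        rw [← constantCoeff_Gfar b h0 hq', ← coeff_zero_eq_constantCoeff_apply]
        exact (Gfar_integral b hq' hn hp2).norm_le_one 0
      have hρ : padicNorm p (classRho b p q σ) ≤ 1 := by
        unfold classRho
        exact (classCofactor_integral b hb hprime hp5 hwin hq').norm_le_one _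
      have hM : padicNorm p ((-(p : ℚ)) ^ ((σ : ℤ) + classExp b p q) * gHat b p q * classRho b p q σ) ≤
          (p : ℚ) ^ (-((σ : ℤ) + classExp b p q)) := by
        rw [padicNorm.mul, padicNorm.mul]
        calc padicNorm p ((-(p : ℚ)) ^ ((σ : ℤ) + classExp b p q)) * padicNorm p (gHat b p q) *
              padicNorm p (classRho b p q σ)
            ≤ padicNorm p ((-(p : ℚ)) ^ ((σ : ℤ) + classExp b p q)) * 1 * 1 :=
              mul_le_mul (mul_le_mul_of_nonneg_left hg (padicNorm.nonneg _)) hρ (padicNorm.nonneg _)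
                (mul_nonneg (padicNorm.nonneg _) zero_le_one)
          _ = (p : ℚ) ^ (-((σ : ℤ) + classExp b p q)) := by rw [mul_one, mul_one, padicNorm_negp_zpow]
      have hsplit : pfData b (σ - 1) q =
          (pfData b (σ - 1) q - (-(p : ℚ)) ^ ((σ : ℤ) + classExp b p q) * gHat b p q * classRho b p q σ) +
            (-(p : ℚ)) ^ ((σ : ℤ) + classExp b p q) * gHat b p q * classRho b p q σ := by ring
      rw [hsplit]
      refine padicNorm.nonarchimedean.trans (max_le ?_ ?_)
      · exact hLD.trans (zpow_le_zpow_right₀ one_le_p (by omega))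
      · exact hM.trans (zpow_le_zpow_right₀ one_le_p (by omega))
  · rw [pfData_eq_zero_of_lt b hb hwin hq' hσ1 hσ6 hA, if_neg (fun h => hA h.1), mul_zero, sub_zero, padicNorm.zero]
    exact zpow_p_nonneg _

/-- **`DigitCongruenceU` is a theorem.** -/
theorem digitCongruenceU_holds : DigitCongruenceU := by
  intro b p m hb hprime hp5 hwin hm hne
  have hm' : ∀ q, q ≤ (b 0).toNat → netExp b q ≤ -((5 : ℕ) : ℤ) → m ≤ ((5 : ℕ) : ℤ) + classExp b p q :=
    fun q hq h => by have := hm q hq (by exact_mod_cast h); exact_mod_cast this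
  exact digitCongruence b m (σ := 5) hb hprime hp5 hwin (by norm_num) (by norm_num) hm' hne

/-- **`DigitCongruenceW` is a theorem.** -/
theorem digitCongruenceW_holds : DigitCongruenceW := by
  intro b p m hb hprime hp5 hwin hm hne
  have hm' : ∀ q, q ≤ (b 0).toNat → netExp b q ≤ -((3 : ℕ) : ℤ) → m ≤ ((3 : ℕ) : ℤ) + classExp b p q :=
    fun q hq h => by have := hm q hq (by exact_mod_cast h); exact_mod_cast this
  exact digitCongruence b m (σ := 3) hb hprime hp5 hwin (by norm_num) (by norm_num) hm' hne


/-! ## The `V` functional: harmonic splitting and the leading digit of `V_x` (REPORT-gen2-g7 §2.3) -/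

/-! ### Harmonic sums: the splitting `p^i H^{(i)}_q ≡ H^{(i)}_{⌊q/p⌋} (mod p^i)` -/

/-- `H^{(i)}_0 = 0`. -/
theorem harm_zero_right (i : ℕ) : harm i 0 = 0 := by
  unfold harm
  rw [sum_range_zero]

/-- `‖p^i‖_p = p^{−i}`. -/
theorem padicNorm_p_pow' {p : ℕ} [hp : Fact p.Prime] (i : ℕ) : padicNorm p ((p : ℚ) ^ i) = (p : ℚ) ^ (-(i : ℤ)) := by
  rw [padicNorm.eq_zpow_of_nonzero (pow_ne_zero _ (Nat.cast_ne_zero.2 hp.out.ne_zero)), padicValRat.pow,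
    padicValRat.self hp.out.one_lt, mul_one]

/-- **HARMONIC SPLITTING** (every `q`, every `i`): `‖p^i H^{(i)}_q − H^{(i)}_{⌊q/p⌋}‖_p ≤ p^{−i}`, i.e.
`H^{(i)}_q = (p-integral) + p^{−i} H^{(i)}_{⌊q/p⌋}` — the multiples of `p` in `1..q` are `p·(1..⌊q/p⌋)`, the rest are units. -/
theorem harm_split_norm {p : ℕ} [hp : Fact p.Prime] (i : ℕ) :
    ∀ q : ℕ, padicNorm p ((p : ℚ) ^ i * harm i q - harm i (q / p)) ≤ (p : ℚ) ^ (-(i : ℤ)) := by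
  have hp0 : (p : ℚ) ≠ 0 := Nat.cast_ne_zero.2 hp.out.ne_zero
  have hpi : (p : ℚ) ^ i ≠ 0 := pow_ne_zero _ hp0
  intro q
  induction q with
  | zero =>
    rw [Nat.zero_div, harm_zero_right, mul_zero, sub_zero, padicNorm.zero]
    exact zpow_p_nonneg _
  | succ q ih =>
    by_cases hdvd : p ∣ q + 1
    · -- the new term `p^i/(q+1)^i` IS the new level term `1/((q+1)/p)^i`
      have hdiv : (q + 1) / p = q / p + 1 := Nat.succ_div_of_dvd hdvd
      have hnat : p * (q / p + 1) = q + 1 := by rw [← hdiv]; exact Nat.mul_div_cancel' hdvd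
      have hcast : ((q : ℚ) + 1) = (p : ℚ) * (((q / p : ℕ) : ℚ) + 1) := by exact_mod_cast hnat.symm
      have e : (p : ℚ) ^ i * harm i (q + 1) - harm i ((q + 1) / p) = (p : ℚ) ^ i * harm i q - harm i (q / p) := by
        rw [hdiv, CellA.harm_succ, CellA.harm_succ, hcast, mul_pow]
        calc (p : ℚ) ^ i * (harm i q + 1 / ((p : ℚ) ^ i * ((((q / p : ℕ) : ℚ) + 1)) ^ i)) -
              (harm i (q / p) + 1 / ((((q / p : ℕ) : ℚ) + 1)) ^ i)
            = (p : ℚ) ^ i * harm i q - harm i (q / p) +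
                ((p : ℚ) ^ i * (1 / ((p : ℚ) ^ i * ((((q / p : ℕ) : ℚ) + 1)) ^ i)) -
                  1 / ((((q / p : ℕ) : ℚ) + 1)) ^ i) := by ring
          _ = (p : ℚ) ^ i * harm i q - harm i (q / p) := by
              rw [mul_one_div, ← div_div, div_self hpi, sub_self, add_zero]
      rw [e]
      exact ih
    · have hdiv : (q + 1) / p = q / p := Nat.succ_div_of_not_dvd hdvd
      have e : (p : ℚ) ^ i * harm i (q + 1) - harm i ((q + 1) / p) =
          ((p : ℚ) ^ i * harm i q - harm i (q / p)) + (p : ℚ) ^ i * (1 / ((q : ℚ) + 1) ^ i) := by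
        rw [hdiv, CellA.harm_succ]
        ring
      rw [e]
      refine padicNorm.nonarchimedean.trans (max_le ih ?_)
      rw [padicNorm.mul, padicNorm_p_pow']
      have h1 := padicNorm_inv_pow_le_one (p := p) hdvd i
      push_cast at h1
      calc (p : ℚ) ^ (-(i : ℤ)) * padicNorm p (1 / ((q : ℚ) + 1) ^ i) ≤ (p : ℚ) ^ (-(i : ℤ)) * 1 :=
            mul_le_mul_of_nonneg_left h1 (zpow_p_nonneg _)
        _ = (p : ℚ) ^ (-(i : ℤ)) := mul_one _

/-- `‖a·b‖_p ≤ t` from `‖a‖_p ≤ 1`, `‖b‖_p ≤ t`. -/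
theorem padicNorm_mul_le_of_le_one {p : ℕ} [hp : Fact p.Prime] {a c t : ℚ} (ha : padicNorm p a ≤ 1)
    (hc : padicNorm p c ≤ t) : padicNorm p (a * c) ≤ t := by
  rw [padicNorm.mul]
  calc padicNorm p a * padicNorm p c ≤ 1 * t := mul_le_mul ha hc (padicNorm.nonneg _) zero_le_one
    _ = t := one_mul t

/-! ### The leading digit of `V_x`, term by term -/

/-- One term of `V_x − (−p)^{E_x}𝒱̂_x`: for `q` in the class and `o < 6` (`σ = o + 1`),
`‖c_{o,q} H^{(σ)}_q − (−p)^{E_x} ĝ_q [σ ≤ n_q] (−1)^σ ρ_{q,σ} H^{(σ)}_{⌊q/p⌋}‖_p ≤ p^{−(E_x+1)}`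
(= `(c − (−p)^{σ+E}ĝρ)·H_q + (−p)^E ĝ ρ (−1)^σ (p^σ H_q − H_{⌊q/p⌋})`: Theorem B times `‖H_q‖ ≤ p^σ`, plus the splitting). -/
theorem vTerm_bound (b : ℕ → ℤ) {p : ℕ} (hb : InPolytope b) (hprime : p.Prime) (hp5 : 5 ≤ p)
    (hwin : (b 0 + 2 : ℤ) < (p : ℤ) ^ 2) {x q : ℕ} (hqC : q ∈ classSet b p x) {o : ℕ} (ho : o < 6) :
    padicNorm p (pfData b o q * harm (o + 1) q - (-(p : ℚ)) ^ classExp b p x * (gHat b p q *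
      (if 1 ≤ o + 1 ∧ ((o + 1 : ℕ) : ℤ) ≤ -netExp b q then
        (-1 : ℚ) ^ (o + 1) * classRho b p q (o + 1) * harm (o + 1) (q / p) else 0))) ≤
      (p : ℚ) ^ (-(classExp b p x + 1)) := by
  haveI : Fact p.Prime := ⟨hprime⟩
  obtain ⟨hbox, -, -, hn⟩ := thmA_data b hb hwin
  have h0 : 0 ≤ b 0 := hbox.1
  have hp2 : p ≠ 2 := by omega
  have hp0 : (p : ℚ) ≠ 0 := Nat.cast_ne_zero.2 hprime.ne_zero
  have hp' : (-(p : ℚ)) ≠ 0 := neg_ne_zero.2 hp0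
  have hqn : q ≤ (b 0).toNat := Nat.lt_succ_iff.1 (mem_range.1 (mem_filter.1 hqC).1)
  have hEq : classExp b p q = classExp b p x := classExp_eq_of_mem hqC
  by_cases hA : ((o + 1 : ℕ) : ℤ) ≤ -netExp b q
  · rw [if_pos ⟨by omega, hA⟩]
    -- Theorem B at `σ = o + 1`, in norm form
    have hLD : padicNorm p (pfData b o q - (-(p : ℚ)) ^ (((o + 1 : ℕ) : ℤ) + classExp b p x) * gHat b p q *
        classRho b p q (o + 1)) ≤ (p : ℚ) ^ (-((((o + 1 : ℕ) : ℤ) + classExp b p x) + 1)) := by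
      have h := fun hne0 => leadingDigit_holds b p q (o + 1) hb hprime hp5 hwin hqn (by omega) hA hne0
      rw [Nat.add_sub_cancel, hEq] at h
      exact padicNorm_le_of_val h
    have hH : padicNorm p (harm (o + 1) q) ≤ (p : ℚ) ^ (((o + 1 : ℕ) : ℤ)) :=
      padicNorm_harm_le (p := p) (lt_of_le_of_lt hqn hn) (o + 1)
    have hsplit := harm_split_norm (p := p) (o + 1) q
    have hg : padicNorm p (gHat b p q) ≤ 1 := by
      rw [← constantCoeff_Gfar b h0 hqn, ← coeff_zero_eq_constantCoeff_apply]
      exact (Gfar_integral b hqn hn hp2).norm_le_one 0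
    have hρ : padicNorm p (classRho b p q (o + 1)) ≤ 1 := by
      unfold classRho
      exact (classCofactor_integral b hb hprime hp5 hwin hqn).norm_le_one _
    have h1 : padicNorm p ((-1 : ℚ) ^ (o + 1)) ≤ 1 := by
      rw [padicNorm.eq_zpow_of_nonzero (pow_ne_zero _ (by norm_num)), padicValRat.pow, padicValRat.neg,
        padicValRat.one, mul_zero, neg_zero, zpow_zero]
    -- the decomposition
    have e : pfData b o q * harm (o + 1) q - (-(p : ℚ)) ^ classExp b p x * (gHat b p q *
          ((-1 : ℚ) ^ (o + 1) * classRho b p q (o + 1) * harm (o + 1) (q / p))) =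
        (pfData b o q - (-(p : ℚ)) ^ (((o + 1 : ℕ) : ℤ) + classExp b p x) * gHat b p q * classRho b p q (o + 1)) *
            harm (o + 1) q +
          (-(p : ℚ)) ^ classExp b p x * ((gHat b p q * (classRho b p q (o + 1) * (-1 : ℚ) ^ (o + 1))) *
            ((p : ℚ) ^ (o + 1) * harm (o + 1) q - harm (o + 1) (q / p))) := by
      rw [zpow_add₀ hp', zpow_natCast, neg_pow (p : ℚ) (o + 1)]
      ring
    rw [e]
    refine padicNorm.nonarchimedean.trans (max_le ?_ ?_)
    · rw [padicNorm.mul]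
      calc padicNorm p (pfData b o q - (-(p : ℚ)) ^ (((o + 1 : ℕ) : ℤ) + classExp b p x) * gHat b p q *
              classRho b p q (o + 1)) * padicNorm p (harm (o + 1) q)
          ≤ (p : ℚ) ^ (-((((o + 1 : ℕ) : ℤ) + classExp b p x) + 1)) * (p : ℚ) ^ (((o + 1 : ℕ) : ℤ)) :=
            mul_le_mul hLD hH (padicNorm.nonneg _) (zpow_p_nonneg _)
        _ = (p : ℚ) ^ (-(classExp b p x + 1)) := by
            rw [← zpow_add₀ hp0]
            congr 1
            ring
    · rw [padicNorm.mul, padicNorm_negp_zpow]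
      have hrest : padicNorm p ((gHat b p q * (classRho b p q (o + 1) * (-1 : ℚ) ^ (o + 1))) *
          ((p : ℚ) ^ (o + 1) * harm (o + 1) q - harm (o + 1) (q / p))) ≤ (p : ℚ) ^ (-(((o + 1 : ℕ) : ℤ))) :=
        padicNorm_mul_le_of_le_one
          (padicNorm_mul_le_of_le_one hg (padicNorm_mul_le_of_le_one hρ h1)) hsplit
      calc (p : ℚ) ^ (-classExp b p x) * padicNorm p ((gHat b p q * (classRho b p q (o + 1) * (-1 : ℚ) ^ (o + 1))) *
              ((p : ℚ) ^ (o + 1) * harm (o + 1) q - harm (o + 1) (q / p)))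
          ≤ (p : ℚ) ^ (-classExp b p x) * (p : ℚ) ^ (-(((o + 1 : ℕ) : ℤ))) :=
            mul_le_mul_of_nonneg_left hrest (zpow_p_nonneg _)
        _ ≤ (p : ℚ) ^ (-(classExp b p x + 1)) := by
            rw [← zpow_add₀ hp0]
            exact zpow_le_zpow_right₀ one_le_p (by push_cast; omega)
  · have hc0 := pfData_eq_zero_of_lt b hb hwin hqn (σ := o + 1) (by omega) (by omega) (by omega)
    rw [Nat.add_sub_cancel] at hc0
    rw [if_neg (fun h => hA h.2), mul_zero, mul_zero, sub_zero, hc0, zero_mul, padicNorm.zero]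
    exact zpow_p_nonneg _

/-- `𝒱̂_x` re-indexed by `o = σ − 1 < 6` over the whole class (non-poles contribute empty inner sums). -/
theorem classVHat_eq (b : ℕ → ℤ) (p x : ℕ) : classVHat b p x = ∑ q ∈ classSet b p x, gHat b p q * ∑ o ∈ range 6,
    (if 1 ≤ o + 1 ∧ ((o + 1 : ℕ) : ℤ) ≤ -netExp b q then
      (-1 : ℚ) ^ (o + 1) * classRho b p q (o + 1) * harm (o + 1) (q / p) else 0) := by
  unfold classVHat
  rw [sum_filter_of_ne]
  · refine sum_congr rfl (fun q _ => ?_)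
    congr 1
    rw [sum_range_succ']
    simp
  · intro q _ hne
    by_contra hge
    apply hne
    have h0 : ∑ σ ∈ range 7, (if 1 ≤ σ ∧ (σ : ℤ) ≤ -netExp b q then
        (-1 : ℚ) ^ σ * classRho b p q σ * harm σ (q / p) else 0) = 0 :=
      sum_eq_zero (fun σ _ => if_neg (by omega))
    rw [h0, mul_zero]

/-- **`LeadingDigitV` is a theorem**: `V_x ≡ (−p)^{E_x} 𝒱̂_x (mod p^{E_x+1})`. -/
theorem leadingDigitV_holds : LeadingDigitV := by
  intro b p x hb hprime hp5 hwin _hx _hpole hne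
  haveI : Fact p.Prime := ⟨hprime⟩
  refine val_ge_of_padicNorm_le hne ?_
  rw [classVHat_eq, classV, mul_sum, ← sum_sub_distrib]
  refine padicNorm.sum_le' (fun q hq => ?_) (zpow_p_nonneg _)
  rw [mul_sum, mul_sum, ← sum_sub_distrib]
  exact padicNorm.sum_le' (fun o ho => vTerm_bound b hb hprime hp5 hwin hq (mem_range.1 ho)) (zpow_p_nonneg _)


end Summit.KontsevichZagierPeriods.Zeta5Search.ClassDigitLaw

end
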